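/-
Copyright (c) 2026. All rights reserved.
Released under Apache 2.0 license as described in the file LICENSE.
-/
import Summits.HodgeConjecture.HodgeConjecture.Theorems.K2LiuArchOnePlaceTubeSection     -- ★ FILE 15 (D-B) `exists_tubeSection_of_reading` (frame-generic)
import Summits.HodgeConjecture.HodgeConjecture.Theorems.K2LiuArchStabIwasawaOfFrame       -- ★ FILE 16 `frame_conj_mul` (+ ★ FILE 14 letters, ★ `K2LiuArchSiegelCharacterTube`)
import Summits.HodgeConjecture.HodgeConjecture.Theorems.K2LiuArchFrameBridge             -- ★ S2-B `kappa_eq`, `moeb_kappa`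
import HarnessLib

/-!
# Crux `HLiu418`, G6-arch ASSEMBLY FILE 17 — (E8rec) DICTIONARY, brick (D-B) AT THE RECORD: a one-place factor of ★ 2c-inst `exists_sum_prod_archPlaces`
# (continuous, one-place Siegel law in SLICE currency, finite under the frame compact `K_fr,w`) IS `F ∘ τ_w` for a tube section `F ∈ I_w(s₀, χ_{−t_w})`
# with a compact picture `Q ∈ ℂ[u, D⁻¹]` — ★ FILE 15 instantiated at the tube frame of record and F0P2-p08's (law) dictionary

Cell `hodgecm-mathlib`, crux item hLiu418 = `stmt-HodgeConjecture-24832` (helper lane `--supports`, count-neutral).  K2Liu-p11 (g4), (E8rec) dictionary;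
consumer: the presentation head `exists_flat_tube_presentation` ⇒ K2Liu-p13 (g4)'s `hArch`.
INPUT CURRENCY = ★ `K2LiuArchCompactPicturePlaceTensor.exists_sum_prod_archPlaces`'s output at a complex place `w` (with `Kw w := K_fr,w = {k | τ_w k ∈ Stab(i1)}`):
`b : archLocal … w → ℂ` continuous, `b (p u) = siegelDeltaCharacter χ s₀ (ι_w p) · b u` for slices `ι_w p ∈ P_Δ(𝔸)`, `b ∈ S` finite-dimensional and stable under `x ↦ x·k`,
`τ_w k ∈ Stab(i1)`.  FRAME LETTERS BY VALUE: `(T, Tinv)` at `w` with `T·Tinv = 1 = Tinv·T`, clause (vi) `hTV`, the Shimura shape `T_w = (D_w D_w; C_w −C_w)`, `D_w, C_w`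
invertible (★ `exists_tubeFrame_arch₄` (x), ★ `isUnit_det_shimuraFrame`), and a READING FRAME `fr : U(2) →* archLocal … w`, continuous, with `τ_w (fr u) = κ(1,u)`
(★ `exists_readingFrame` + ★ `tube_eq_of_chart_formula`).  OUTPUT = ★ (E8) END's section currency.
* **`exists_tubeSection_of_frame`** — `∃ F Q, IsArchSiegelSection (z ↦ (z̄∕‖z‖)^{−t_w}) s₀ F ∧ cp F = Q ∧ ∀ x, F (T_w · x̃ · T_w⁻¹) = b x`
  (`τ_w` as a `MonoidHom` by ★ `frame_conj_mul`; injective by ★ `eq_of_frame_conj_eq`; the tube law from the slice law by ★ `isSiegelDelta_slice_of_toBlocks₂₁` + ★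
  `siegelDeltaCharacter_archPlace`; `fr u ∈ K_fr,w` by ★ `kappa_eq` + ★ `moeb_kappa`; then ★ FILE 15).
References: [Shimura1997, §§5–6, §16.4]; [Kudla1994, §3]; [LeeZhu1998, §5 p. 5032]; [BorelJacquet1979, §4.1].
HONEST LABEL: HC_CM is proved only modulo the 7 printed citations (2 remaining named inputs: hLiu418 = stmt-HodgeConjecture-24832,
h413 = stmt-HodgeConjecture-24833) until rung 0 closes; count-neutral helper, closes no socket.
-/

set_option autoImplicit false
set_option linter.dupNamespace false

noncomputable section

open scoped Matrix ComplexConjugate Classical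
open Complex Matrix NumberField NumberField.InfinitePlace
open Literature.NumberTheory.ModularForms.SiegelUpperHalfSpace (denom moeb)
open Literature.NumberTheory.Automorphic Literature.NumberTheory.Automorphic.UnitaryGroup Literature.NumberTheory.GaloisRepresentations
open Literature.NumberTheory.GelbartRogawski1991 Literature.NumberTheory.GelbartRogawski1991.GRConstruction
open Literature.NumberTheory.GelbartRogawski1991.UnitaryDualPair
open Literature.NumberTheory.K2Lit.SiegelDoubled

namespace Summit.HodgeConjecture.HodgeConjecture.Cruxes.HLiu418.K2LiuArchOnePlaceTubeSectionOfFrame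

open K2LiuU22CompactPictureDefs K2LiuArchInducedTubeDefs K2LiuArchFrameBridge K2LiuHolTubeRigidityOfFrame K2LiuArchSiegelCharacterTube
open K2LiuArchOnePlaceTubeSection (exists_tubeSection_of_reading)
open K2LiuArchStabIwasawaOfFrame (frame_conj_mul)

variable (L : Type) [Field L] [NumberField L] [IsCMField L] {N M : ℕ} (e : Fin N × Fin M ≃ Fin 2)
  (dV : Fin N → L) (hdV : ∀ i, IsCMField.complexConj L (dV i) = dV i)
  (dW : Fin M → L) (hdW : ∀ i, IsCMField.complexConj L (dW i) = dW i)
  (w : {w : InfinitePlace L // w.IsComplex})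
  (T Tinv : {w : InfinitePlace L // w.IsComplex} → Matrix (Fin 2 ⊕ Fin 2) (Fin 2 ⊕ Fin 2) ℂ)
  (hT1 : ∀ w, T w * Tinv w = 1) (hT2 : ∀ w, Tinv w * T w = 1)
  (hTV : ∀ w (P : Matrix (Fin 2 ⊕ Fin 2) (Fin 2 ⊕ Fin 2) ℂ), Pᴴ * Matrix.J (Fin 2) ℂ * P = Matrix.J (Fin 2) ℂ →
    ∃ g : GL (Fin (2 + 2)) ℂ, g ∈ UnitaryGroup.archLocal L (2 + 2) (hermD L e dV hdV dW hdW) w ∧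
      T w * Matrix.reindex (e₂ (n := 2)).symm (e₂ (n := 2)).symm (g : Matrix _ _ ℂ) * Tinv w = P)
  (D C : {w : InfinitePlace L // w.IsComplex} → Matrix (Fin 2) (Fin 2) ℂ)
  (hTsh : ∀ w, T w = fromBlocks (D w) (D w) (C w) (-(C w))) (hD : ∀ w, IsUnit (D w).det) (hC : ∀ w, IsUnit (C w).det)

include hT1 hT2 hTV hTsh hD hC in
/-- **A ONE-PLACE FACTOR OF THE RECORD IS A FRAMED TUBE SECTION WITH A COMPACT PICTURE.**  See the module docstring for the letters; the weight is `k_w = −t_w` for a Hecke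
character of unitary archimedean type `(t, 0)` (★ `siegelDeltaCharacter_archPlace`). [Shimura1997, §16.4] [Kudla1994, §3] [LeeZhu1998, §5] [BorelJacquet1979, §4.1] -/
theorem exists_tubeSection_of_frame
    (fr : Matrix.unitaryGroup (Fin 2) ℂ →* UnitaryGroup.archLocal L (2 + 2) (hermD L e dV hdV dW hdW) w) (hfrc : Continuous fr)
    (hfrτ : ∀ u : Matrix.unitaryGroup (Fin 2) ℂ,
      T w * Matrix.reindex (e₂ (n := 2)).symm (e₂ (n := 2)).symm (((fr u : UnitaryGroup.archLocal L (2 + 2) (hermD L e dV hdV dW hdW) w) : GL (Fin (2 + 2)) ℂ) :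
        Matrix (Fin (2 + 2)) (Fin (2 + 2)) ℂ) * Tinv w =
      (2 : ℂ)⁻¹ • fromBlocks (1 + (u : Matrix (Fin 2) (Fin 2) ℂ)) (-(I • (1 - (u : Matrix (Fin 2) (Fin 2) ℂ)))) (I • (1 - (u : Matrix (Fin 2) (Fin 2) ℂ))) (1 + (u : Matrix (Fin 2) (Fin 2) ℂ)))
    {χ : HeckeCharacter L} {t : InfinitePlace L → ℤ} (ht : χ.HasUnitaryArchType t 0) (s₀ : ℂ)
    (b : UnitaryGroup.archLocal L (2 + 2) (hermD L e dV hdV dW hdW) w → ℂ) (hbc : Continuous b)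
    (hlaw : ∀ p : UnitaryGroup.archLocal L (2 + 2) (hermD L e dV hdV dW hdW) w,
      IsSiegelDelta L e dV hdV dW hdW (UnitaryGroup.archToAdelic (Fp L) L (IsCMField.complexConj L) (2 + 2) (hermD L e dV hdV dW hdW)
        ((UnitaryGroup.archPiEquivCM (2 + 2) L (hermD L e dV hdV dW hdW)).symm (Pi.mulSingle w p))) →
      ∀ u, b (p * u) =
        siegelDeltaCharacter L e dV hdV dW hdW χ s₀ (UnitaryGroup.archToAdelic (Fp L) L (IsCMField.complexConj L) (2 + 2) (hermD L e dV hdV dW hdW)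
          ((UnitaryGroup.archPiEquivCM (2 + 2) L (hermD L e dV hdV dW hdW)).symm (Pi.mulSingle w p))) * b u)
    (S : Submodule ℂ (UnitaryGroup.archLocal L (2 + 2) (hermD L e dV hdV dW hdW) w → ℂ)) [FiniteDimensional ℂ S] (hbS : b ∈ S)
    (hS : ∀ f ∈ S, ∀ k : UnitaryGroup.archLocal L (2 + 2) (hermD L e dV hdV dW hdW) w,
      moeb (T w * Matrix.reindex (e₂ (n := 2)).symm (e₂ (n := 2)).symm ((k : GL (Fin (2 + 2)) ℂ) : Matrix (Fin (2 + 2)) (Fin (2 + 2)) ℂ) * Tinv w)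
        (I • (1 : Matrix (Fin 2) (Fin 2) ℂ)) = I • 1 → (fun x => f (x * k)) ∈ S) :
    ∃ (F : Matrix (Fin 2 ⊕ Fin 2) (Fin 2 ⊕ Fin 2) ℂ → ℂ) (Q : Carrier),
      IsArchSiegelSection (fun z : ℂ => (conj z / ((‖z‖ : ℝ) : ℂ)) ^ (-(t w.1))) s₀ F ∧
      (∀ (v : Matrix (Fin 2) (Fin 2) ℂ), vᴴ * v = 1 → ∀ hv : v.det ≠ 0,
        F ((2 : ℂ)⁻¹ • fromBlocks (1 + v) (-(I • (1 - v))) (I • (1 - v)) (1 + v) : Matrix (Fin 2 ⊕ Fin 2) (Fin 2 ⊕ Fin 2) ℂ) = evalAt v hv Q) ∧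
      ∀ x : UnitaryGroup.archLocal L (2 + 2) (hermD L e dV hdV dW hdW) w,
        F (T w * Matrix.reindex (e₂ (n := 2)).symm (e₂ (n := 2)).symm ((x : GL (Fin (2 + 2)) ℂ) : Matrix (Fin (2 + 2)) (Fin (2 + 2)) ℂ) * Tinv w) = b x := by
  -- the frame at `w` as a monoid homomorphism `τ : archLocal w →* M₄(ℂ)` (kept opaque, with its defining equation)
  obtain ⟨τ, hτ⟩ : ∃ τ : UnitaryGroup.archLocal L (2 + 2) (hermD L e dV hdV dW hdW) w →* Matrix (Fin 2 ⊕ Fin 2) (Fin 2 ⊕ Fin 2) ℂ,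
      ∀ x, τ x = T w * Matrix.reindex (e₂ (n := 2)).symm (e₂ (n := 2)).symm ((x : GL (Fin (2 + 2)) ℂ) : Matrix (Fin (2 + 2)) (Fin (2 + 2)) ℂ) * Tinv w :=
    ⟨{ toFun := fun x => T w * Matrix.reindex (e₂ (n := 2)).symm (e₂ (n := 2)).symm ((x : GL (Fin (2 + 2)) ℂ) : Matrix (Fin (2 + 2)) (Fin (2 + 2)) ℂ) * Tinv w
       map_one' := by
         simp only [OneMemClass.coe_one, Units.val_one, Matrix.reindex_apply, Matrix.submatrix_one_equiv, Matrix.mul_one]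
         exact hT1 w
       map_mul' := fun x y => by
         simp only [Subgroup.coe_mul]
         exact frame_conj_mul L T Tinv hT2 w _ _ }, fun _ => rfl⟩
  have hτinj : Function.Injective τ := fun x y hxy => by
    rw [hτ, hτ] at hxy
    exact Subtype.ext (Units.ext ((Matrix.reindex (e₂ (n := 2)).symm (e₂ (n := 2)).symm).injective (eq_of_frame_conj_eq L T Tinv (hT2 w) hxy)))
  have hτsurj : ∀ P : Matrix (Fin 2 ⊕ Fin 2) (Fin 2 ⊕ Fin 2) ℂ, Pᴴ * Matrix.J (Fin 2) ℂ * P = Matrix.J (Fin 2) ℂ → ∃ g, τ g = P := fun P hP => by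
    obtain ⟨g, hg, hgP⟩ := hTV w P hP
    exact ⟨⟨g, hg⟩, by rw [hτ]; exact hgP⟩
  have hinv : Tinv w * fromBlocks (D w) (D w) (C w) (-(C w)) = 1 := by rw [← hTsh]; exact hT2 w
  -- the slice law in tube letters (F0P2-p08's dictionary)
  have hlaw' : ∀ p g : UnitaryGroup.archLocal L (2 + 2) (hermD L e dV hdV dW hdW) w, (τ p).toBlocks₂₁ = 0 →
      b (p * g) = (fun z : ℂ => (conj z / ((‖z‖ : ℝ) : ℂ)) ^ (-(t w.1))) (τ p).toBlocks₁₁.det *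
        (((‖(τ p).toBlocks₁₁.det‖ : ℝ) : ℂ) ^ (2 * s₀ + (Fintype.card (Fin 2) : ℂ))) * b g := by
    intro p g hp21
    rw [hτ] at hp21 ⊢
    have hP : (fromBlocks (D w) (D w) (C w) (-(C w)) * Matrix.reindex (e₂ (n := 2)).symm (e₂ (n := 2)).symm ((p : GL (Fin (2 + 2)) ℂ) : Matrix (Fin (2 + 2)) (Fin (2 + 2)) ℂ) *
        Tinv w).toBlocks₂₁ = 0 := by rw [← hTsh]; exact hp21
    rw [hlaw p (isSiegelDelta_slice_of_toBlocks₂₁ L e dV hdV dW hdW w (D w) (C w) (Tinv w) hinv (hC w) p hP) g,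
      siegelDeltaCharacter_archPlace L e dV hdV dW hdW w (D w) (C w) (Tinv w) hinv (hD w) (hC w) p hP ht s₀, ← hTsh, Fintype.card_fin]
  -- the reading frame lands in the frame compact
  have hS' : ∀ f ∈ S, ∀ u : Matrix.unitaryGroup (Fin 2) ℂ, (fun x => f (x * fr u)) ∈ S := fun f hf u =>
    hS f hf (fr u) (by
      rw [hfrτ u, ← kappa_eq]
      exact moeb_kappa (by rw [conjTranspose_one, Matrix.one_mul]) (Matrix.mem_unitaryGroup_iff'.1 u.2))
  obtain ⟨F, Q, hF, hQ, hFb⟩ := exists_tubeSection_of_reading τ hτinj hτsurj fr hfrc (fun u => by rw [hτ]; exact hfrτ u)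
    (fun z : ℂ => (conj z / ((‖z‖ : ℝ) : ℂ)) ^ (-(t w.1))) s₀ b hbc hlaw' S hbS hS'
  exact ⟨F, Q, hF, hQ, fun x => by rw [← hτ]; exact hFb x⟩

end Summit.HodgeConjecture.HodgeConjecture.Cruxes.HLiu418.K2LiuArchOnePlaceTubeSectionOfFrame

end
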